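import Summits.AnomalousDissipation.AnomalousDissipation.Theorems.SawtoothPulseCascadeK1LocalisedCascadeSpectralMoments

/-!
# K1loc, line `Spectral` / SeqCone — helper: SPECTRAL MOMENTS OF A SHEAR PHASE `e^{−2πinQ}` (residual-shear leakage data)

Helper file of the prover lane on the crux `K1LocalisedCascade` (stmt-AnomalousDissipation-19491), route
`SawtoothPulseCascade` (glue seat k1loc-p3; socket (a) of ad-k1loc-p2's A4: the residual shear `Φ_{γ(U_j − Ũ_j)}` is passed
through `…KoopmanLeakage.sqrt_tsum_symbol_sq_comp_shearMap_fibre_le`, which charges the fibre `k_i = n` with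
`Σ_q ω(q)‖𝓕(x ↦ g_n(x_j))(q)‖`, `g_n = Torus.twist Q n = e^{−2πinQ}`).  For ANY shear profile `Q` with `|Q′| ≤ D₁`, `|Q″| ≤ D₂`:
* `iteratedDeriv_two_cexp_mul` / `norm_iteratedDeriv_two_cexp_mul_le` — `F = e^{−2πinQ}` has `F″ = ((−2πin Q′)² − 2πin Q″)F`,
  `‖F″‖ ≤ (2π|n|D₁)² + 2π|n|D₂`;
* `tsum_abs_mul_norm_mFourierCoeff_twist_le` — **Sobolev–Wiener for the phase**:
  `Σ_q |q_j|·‖𝓕(x ↦ g_n(x_j))(q)‖ ≤ ((2π|n|D₁)² + 2π|n|D₂)/(4π√3)` (with summability, and `Σ_q ‖𝓕(x ↦ g_n(x_j))(q)‖ < ∞`);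
* `tsum_modulus_mul_norm_mFourierCoeff_twist_le` — against the fibrewise modulus `ω(q) = ω₁|q_j|` (axis) / `2M₀` (off):
  `Σ_q ω(q)‖𝓕(x ↦ g_n(x_j))(q)‖ ≤ ω₁((2π|n|D₁)² + 2π|n|D₂)/(4π√3)` = the constant `A_res(n)` of the residual shear
  (`D₁ = 2γδ_A`, `D₂` from `…ResidualShear`).
No definitions; no statement about the stub.  [cite: Grafakos2014, Prop. 3.1.2 (5) and Prop. 3.2.7 (3)] [problem: turb]
-/

-- `Summit.<Summit>.<Problem>`: single-conjunct summit, the duplicate namespace segment is deliberate.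
set_option linter.dupNamespace false

noncomputable section

namespace Summit.AnomalousDissipation.AnomalousDissipation.Theorems.SawtoothPulseCascade.K1Slot

open MeasureTheory Set Filter Topology UnitAddTorus Complex
open Literature.Analysis Literature.Analysis.FunctionSpaces Literature.Analysis.FunctionSpaces.Torus
open Summit.AnomalousDissipation.AnomalousDissipation.Theorems.SawtoothPulseCascade.K1Cutoff
open scoped ContDiff

variable {d : Type*} [Fintype d] [DecidableEq d]

/-! ## The phase `F = e^{−2πinQ}` on the line: first two derivatives -/

/-- `F(y) = e^{−2πinQ(y)}` has derivative `(−2πin Q′(y))·F(y)`. [folklore] -/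
theorem hasDerivAt_cexp_mul (Q : ShearProfile) (n : ℤ) (y : ℝ) :
    HasDerivAt (fun y : ℝ => Complex.exp (-(2 * Real.pi * I * n * Q y)))
      ((-(2 * Real.pi * I * n * ((deriv Q y : ℝ) : ℂ))) * Complex.exp (-(2 * Real.pi * I * n * Q y))) y := by
  have hQ : HasDerivAt (fun y : ℝ => (Q y : ℂ)) ((deriv Q y : ℝ) : ℂ) y :=
    (Q.contDiff.differentiable (by simp) y).hasDerivAt.ofReal_comp
  have hin : HasDerivAt (fun y : ℝ => -(2 * Real.pi * I * n * (Q y : ℂ))) (-(2 * Real.pi * I * n * ((deriv Q y : ℝ) : ℂ))) y :=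
    (hQ.const_mul (2 * Real.pi * I * n)).neg
  have h := hin.cexp
  convert h using 1
  ring

/-- The derivative of `F = e^{−2πinQ}` as a function. [folklore] -/
theorem deriv_cexp_mul (Q : ShearProfile) (n : ℤ) :
    deriv (fun y : ℝ => Complex.exp (-(2 * Real.pi * I * n * Q y))) =
      fun y => (-(2 * Real.pi * I * n * ((deriv Q y : ℝ) : ℂ))) * Complex.exp (-(2 * Real.pi * I * n * Q y)) :=
  funext fun y => (hasDerivAt_cexp_mul Q n y).deriv

/-- **Second derivative of the phase**: `F″(y) = (−2πin Q″(y) + (2πin Q′(y))²)·F(y)`. [folklore] -/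
theorem iteratedDeriv_two_cexp_mul (Q : ShearProfile) (n : ℤ) (y : ℝ) :
    iteratedDeriv 2 (fun y : ℝ => Complex.exp (-(2 * Real.pi * I * n * Q y))) y =
      (-(2 * Real.pi * I * n * ((deriv (deriv Q) y : ℝ) : ℂ)) + (2 * Real.pi * I * n * ((deriv Q y : ℝ) : ℂ)) ^ 2) *
        Complex.exp (-(2 * Real.pi * I * n * Q y)) := by
  rw [iteratedDeriv_succ, iteratedDeriv_one, deriv_cexp_mul]
  have hdQ : Differentiable ℝ (deriv Q) := (contDiff_infty_iff_deriv.1 Q.contDiff).2.differentiable (by simp)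
  have hQ' : HasDerivAt (fun y : ℝ => ((deriv Q y : ℝ) : ℂ)) ((deriv (deriv Q) y : ℝ) : ℂ) y :=
    (hdQ y).hasDerivAt.ofReal_comp
  have h1 : HasDerivAt (fun y : ℝ => -(2 * Real.pi * I * n * ((deriv Q y : ℝ) : ℂ)))
      (-(2 * Real.pi * I * n * ((deriv (deriv Q) y : ℝ) : ℂ))) y :=
    (hQ'.const_mul (2 * Real.pi * I * n)).neg
  have h : HasDerivAt (fun y : ℝ => (-(2 * Real.pi * I * n * ((deriv Q y : ℝ) : ℂ))) *
      Complex.exp (-(2 * Real.pi * I * n * Q y))) _ y := h1.mul (hasDerivAt_cexp_mul Q n y)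
  rw [h.deriv]
  ring

/-- **Sup bound of the second derivative of the phase**: `‖F″(y)‖ ≤ 2π|n|D₂ + (2π|n|D₁)²` if `|Q′| ≤ D₁`, `|Q″| ≤ D₂`.
[folklore] -/
theorem norm_iteratedDeriv_two_cexp_mul_le (Q : ShearProfile) (n : ℤ) {D₁ D₂ : ℝ} (hD₁ : ∀ y, |deriv Q y| ≤ D₁)
    (hD₂ : ∀ y, |deriv (deriv Q) y| ≤ D₂) (y : ℝ) :
    ‖iteratedDeriv 2 (fun y : ℝ => Complex.exp (-(2 * Real.pi * I * n * Q y))) y‖ ≤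
      2 * Real.pi * |(n : ℝ)| * D₂ + (2 * Real.pi * |(n : ℝ)| * D₁) ^ 2 := by
  have hD₁0 : 0 ≤ D₁ := (abs_nonneg _).trans (hD₁ 0)
  rw [iteratedDeriv_two_cexp_mul, norm_mul]
  have hexp : ‖Complex.exp (-(2 * Real.pi * I * n * Q y))‖ = 1 := by
    rw [Complex.norm_exp]; simp
  rw [hexp, mul_one]
  have hc : ‖(2 * Real.pi * I * n : ℂ)‖ = 2 * Real.pi * |(n : ℝ)| := by
    rw [norm_mul, norm_mul, norm_mul, Complex.norm_I, mul_one, Complex.norm_intCast, Complex.norm_ofNat, Complex.norm_real,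
      Real.norm_eq_abs, abs_of_pos Real.pi_pos]
  refine (norm_add_le _ _).trans (add_le_add ?_ ?_)
  · rw [norm_neg, norm_mul, hc, Complex.norm_real, Real.norm_eq_abs]
    exact mul_le_mul_of_nonneg_left (hD₂ y) (by positivity)
  · rw [norm_pow, norm_mul, hc, Complex.norm_real, Real.norm_eq_abs]
    exact pow_le_pow_left₀ (by positivity) (mul_le_mul_of_nonneg_left (hD₁ y) (by positivity)) 2

/-! ## Sobolev–Wiener for the phase read off `x_j` -/

/-- **Spectral moment of a shear phase.**  For a shear profile `Q` with `|Q′| ≤ D₁`, `|Q″| ≤ D₂` and every mode `n`: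
`Σ_q |q_j|·‖𝓕(x ↦ g_n(x_j))(q)‖ ≤ (2π|n|D₂ + (2π|n|D₁)²)/(4π√3)`, `g_n = twist Q n = e^{−2πinQ}`; with the summability of this
series and of `Σ_q ‖𝓕(x ↦ g_n(x_j))(q)‖`. [cite: Grafakos2014, Prop. 3.1.2 (5) and Prop. 3.2.7 (3)] -/
theorem tsum_abs_mul_norm_mFourierCoeff_twist_le (Q : ShearProfile) (n : ℤ) (j : d) {D₁ D₂ : ℝ}
    (hD₁ : ∀ y, |deriv Q y| ≤ D₁) (hD₂ : ∀ y, |deriv (deriv Q) y| ≤ D₂) :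
    (Summable fun q : d → ℤ => ‖mFourierCoeff (fun x : UnitAddTorus d => twist Q n (x j)) q‖) ∧
    (Summable fun q : d → ℤ => |(q j : ℝ)| * ‖mFourierCoeff (fun x : UnitAddTorus d => twist Q n (x j)) q‖) ∧
    ∑' q : d → ℤ, |(q j : ℝ)| * ‖mFourierCoeff (fun x : UnitAddTorus d => twist Q n (x j)) q‖ ≤
      (2 * Real.pi * |(n : ℝ)| * D₂ + (2 * Real.pi * |(n : ℝ)| * D₁) ^ 2) / (4 * Real.pi * Real.sqrt 3) := by
  classical
  set F : ℝ → ℂ := fun y => Complex.exp (-(2 * Real.pi * I * n * Q y)) with hF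
  have hFc : ContDiff ℝ ∞ F := Complex.contDiff_exp.comp ((contDiff_const.mul (ofRealCLM.contDiff.comp Q.contDiff)).neg)
  have hp0 : Function.Periodic F 1 := fun y => by simp only [hF, Q.periodic y]
  have hp : ∀ α, Function.Periodic (iteratedDeriv α F) 1 := fun α => periodic_iteratedDeriv hp0 α
  have hd : ∀ α y, HasDerivAt (iteratedDeriv α F) (iteratedDeriv (α + 1) F y) y := by
    intro α y
    have hdiff : Differentiable ℝ (iteratedDeriv α F) := by
      rw [iteratedDeriv_eq_iterate]; exact (hFc.iterate_deriv α).differentiable (by simp)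
    rw [iteratedDeriv_succ]
    exact (hdiff y).hasDerivAt
  have hc : ∀ α, Continuous (iteratedDeriv α F) := fun α => by
    rw [iteratedDeriv_eq_iterate]; exact (hFc.iterate_deriv α).continuous
  set Θ : ℕ → UnitAddTorus d → ℂ := fun α x => ((hp α).lift : UnitAddCircle → ℂ) (x j) with hΘ
  have hrel : ∀ α q, mFourierCoeff (Θ α) q = (2 * Real.pi * I * (q j : ℂ)) ^ α * mFourierCoeff (Θ 0) q :=
    fun α q => mFourierCoeff_comp_eval_periodicLift_iterate hp hd hc j α q
  have hΘ0 : Θ 0 = fun x : UnitAddTorus d => twist Q n (x j) := by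
    funext x
    simp only [hΘ]
    induction x j using QuotientAddGroup.induction_on with
    | H y => rw [(hp 0).lift_coe, iteratedDeriv_zero, twist_coe]
  have hsm0 : IsSmooth (Θ 0) := isSmooth_comp_eval_periodicLift (hp 0) (by rw [iteratedDeriv_zero]; exact hFc) j
  have haxis : ∀ (q : d → ℤ) (l : d), l ≠ j → q l ≠ 0 → mFourierCoeff (Θ 0) q = 0 := by
    intro q l hl hq
    have h := mFourierCoeff_comp_eval (G := ((hp 0).lift : UnitAddCircle → ℂ))
      (continuous_periodicLift (hc 0) (hp 0)) j q
    rw [if_neg (by push Not; exact ⟨l, hl, hq⟩)] at h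
    exact h
  have hΘ2c : Continuous (Θ 2) :=
    (isSmooth_comp_eval_periodicLift (hp 2) (by rw [iteratedDeriv_eq_iterate]; exact hFc.iterate_deriv 2) j).continuous
  have hB : ∀ x, ‖Θ 2 x‖ ≤ 2 * Real.pi * |(n : ℝ)| * D₂ + (2 * Real.pi * |(n : ℝ)| * D₁) ^ 2 := fun x =>
    norm_comp_eval_periodicLift_le (hp 2) (fun y => norm_iteratedDeriv_two_cexp_mul_le Q n hD₁ hD₂ y) j x
  obtain ⟨hs, hle⟩ := tsum_abs_mul_norm_mFourierCoeff_le j hrel haxis hΘ2c hB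
  rw [hΘ0] at hs hle
  exact ⟨hΘ0 ▸ hsm0.rapidDecay_mFourierCoeff.summable_norm, hs, hle⟩

/-- **The residual-shear leakage constant**: against the fibrewise modulus `ω(q) = ω₁|q_j|` on the `e_j`-axis, `2M₀` off it
(`…SpectralMoments.modulus_of_fibre_lipschitz`), the phase `g_n = e^{−2πinQ}` read off `x_j` has
`Σ_q ω(q)‖𝓕(x ↦ g_n(x_j))(q)‖ ≤ ω₁·(2π|n|D₂ + (2π|n|D₁)²)/(4π√3)` with the summability — the hypotheses `hωs` and the
constant of `…KoopmanLeakage.sqrt_tsum_symbol_sq_comp_shearMap_fibre_le`. [cite: Grafakos2014, Prop. 3.1.2 (5) and Prop. 3.2.7 (3)] -/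
theorem tsum_modulus_mul_norm_mFourierCoeff_twist_le (Q : ShearProfile) (n : ℤ) (j : d) {D₁ D₂ M₀ ω₁ : ℝ} (hω₁ : 0 ≤ ω₁)
    (hD₁ : ∀ y, |deriv Q y| ≤ D₁) (hD₂ : ∀ y, |deriv (deriv Q) y| ≤ D₂) :
    (Summable fun q : d → ℤ => (if (∀ l, l ≠ j → q l = 0) then ω₁ * |(q j : ℝ)| else 2 * M₀) *
      ‖mFourierCoeff (fun x : UnitAddTorus d => twist Q n (x j)) q‖) ∧
    ∑' q : d → ℤ, (if (∀ l, l ≠ j → q l = 0) then ω₁ * |(q j : ℝ)| else 2 * M₀) *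
      ‖mFourierCoeff (fun x : UnitAddTorus d => twist Q n (x j)) q‖ ≤
      ω₁ * ((2 * Real.pi * |(n : ℝ)| * D₂ + (2 * Real.pi * |(n : ℝ)| * D₁) ^ 2) / (4 * Real.pi * Real.sqrt 3)) := by
  classical
  obtain ⟨-, hs, hle⟩ := tsum_abs_mul_norm_mFourierCoeff_twist_le Q n j hD₁ hD₂
  have haxis : ∀ (q : d → ℤ) (l : d), l ≠ j → q l ≠ 0 →
      mFourierCoeff (fun x : UnitAddTorus d => twist Q n (x j)) q = 0 := by
    intro q l hl hq
    have h := mFourierCoeff_comp_eval (G := twist Q n) (continuous_twist Q n) j q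
    rw [if_neg (by push Not; exact ⟨l, hl, hq⟩)] at h
    exact h
  have heq : (fun q : d → ℤ => (if (∀ l, l ≠ j → q l = 0) then ω₁ * |(q j : ℝ)| else 2 * M₀) *
      ‖mFourierCoeff (fun x : UnitAddTorus d => twist Q n (x j)) q‖) =
      fun q => ω₁ * (|(q j : ℝ)| * ‖mFourierCoeff (fun x : UnitAddTorus d => twist Q n (x j)) q‖) := by
    funext q
    split_ifs with hq
    · ring
    · push Not at hq
      obtain ⟨l, hl, hql⟩ := hq
      rw [haxis q l hl hql, norm_zero, mul_zero, mul_zero, mul_zero]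
  rw [heq]
  exact ⟨hs.mul_left ω₁, by rw [tsum_mul_left]; exact mul_le_mul_of_nonneg_left hle hω₁⟩

end Summit.AnomalousDissipation.AnomalousDissipation.Theorems.SawtoothPulseCascade.K1Slot
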